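import Summits.QuantumFields.QCD.Theorems.SmallFieldUltracontractivity.Negative.Tightness
import Literature.Probability.LatticeModels.TorusFourierProofs
import Summits.QuantumFields.QCD.Theorems.HeatSlicedQuarksSmallFieldUltracontractivityStubDiagonalMonotone
import Summits.QuantumFields.QCD.Theorems.HeatSlicedQuarksSmallFieldUltracontractivityStubGaugeTransfer
import Summits.QuantumFields.QCD.Theorems.HeatSlicedQuarksSmallFieldUltracontractivityStubGaugeCovariance
import Summits.QuantumFields.QCD.Theorems.HeatSlicedQuarksSmallFieldUltracontractivityStubFreeKernelFourier
import Summits.QuantumFields.QCD.Theorems.HeatSlicedQuarksSmallFieldUltracontractivityStubFreeRowBounds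
import Summits.QuantumFields.QCD.Theorems.HeatSlicedQuarksSmallFieldUltracontractivityStubCombGauge
import Summits.QuantumFields.QCD.Theorems.HeatSlicedQuarksSmallFieldUltracontractivityFixedPointE
import Summits.QuantumFields.QCD.Theorems.HeatSlicedQuarksSmallFieldUltracontractivityStubFreeKernelDecay

/-!
# Line `point-centred-axial-parabolic` — the crux proof (all seven stubs landed) for the crux `SmallFieldUltracontractivity`
(item stmt-QuantumFields-8871, route `HeatSlicedQuarks`, rank-2 crux; line lead
prover-line-stmt-QuantumFields-8871-0, 2026-08-16; reshaped from the crux-plan skeleton of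
planner-cruxplan-stmt-QuantumFields-8871-point-centred-axial--0)

Crux (by name, never restated as a target): `Summit.QuantumFields.QCD.Theses.HeatSlicedQuarks.SmallFieldUltracontractivity`
— `∃ ε > 0, K, C` such that on every torus, for every `SU(3)` field `U`, mass `m ∈ [-1/2, 1]`, site `x`,
scale `1 ≤ r ≤ L`: plaquette deficits `3 - Re tr U_p ≤ (ε/r²)²` on the `torusDist`-ball of radius `K·r`
around `x` imply `|e^{-t D_Wᴴ D_W}((x,a,α),(x,b,β))| ≤ C/t²` for `1 ≤ t ≤ r²`.

## The line (idea `point-centred-axial-parabolic`)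

LEVER: in the complete axial ("comb") gauge centred at `x` on a non-wrapping cube, plaquette
smallness `δ` becomes LINK smallness growing linearly with the distance (`stub_combGauge`), so at the
working scale `ρ ≍ √s ≤ ℓ` the perturbation `E := D_W(U) - D_W(1)` is a bounded hopping operator of
size `≍ κ/ℓ ≤ κ/ρ`; the dimensionless coupling is geometric in the scale (scale covariance, the
Disproof's §B near-miss).  ENGINE: the T*T / sup-principle form of the crux (Disproof §C; Tightness
`exp_neg_smul_apply_self_eq_sum_norm_sq`) is a LOCAL `ℓ² → ℓ^∞` bound for `u(τ) = e^{-τH_U} f`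
("LocalSupBound", the conclusion of `stub_caloricBootstrap`), proved by ONE cut-off Duhamel step around
the FREE MASSIVE Wilson kernel (`stub_freeKernelDecay`: parabolic polynomial decay of the free kernel and
of its nearest-neighbour differences, with the mass decay `e^{-cσm²}`) and closed as a sup-norm fixed
point `M ≤ C₀ + C₁(κ + κ²)M` (`stub_caloricBootstrap`, the research content); the free comparison
operator is the MASSIVE free operator `D₁ = wilsonDirac ρ 1 m 1` (never split `m` off:
`H_U - H₁ = D₁ᴴE + EᴴD_U`), `E` is never differenced (the free difference always lands on the free
kernel, paid by `√(1+σ)`), the derivative on `u` is handled by the `Q_U = γ₅D_U` trick, the exterior of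
the ball enters only through `‖e^{-τH_U}‖_{2→2} ≤ 1`.  TRANSFER: gauge covariance of the colour-summed
diagonal (`stub_gaugeCovariance`), monotonicity of the diagonal in `t` (`stub_diagonalMonotone`), comb
gauge + scale arithmetic (`stub_gaugeTransfer`).

## Stubs (7) and composition (lead's reshape, 2026-08-16; statements written out, no local `def`s, so
that each stub lands verbatim as `Theorems/HeatSlicedQuarksSmallFieldUltracontractivity<Stub>.lean`)

* `stub_combGauge`         (M)  — "CombGauge" (unchanged from the plan).
* `stub_freeKernelFourier` (S/M) — "FreeKernelFourier": the massive free heat kernel in torus Fourier variables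
  (the tree's `exp_freeWilson_apply` with the mass restored).
* `stub_freeKernelDecay`   (L)  — "FreeKernelFourier → FreeKernelDecay" (replaces the plan's exponential `FreeKernelEnvelope`:
  parabolic polynomial decay `(1+σ)/(1+σ+d²)³` for entries and `√(1+σ)/(1+σ+d²)³` for nearest-neighbour
  column differences, both with `e^{-cσm²}` — exactly what the bootstrap consumes; real-variable Fourier
  analysis, six `p`-derivatives of the symbol, no contour shift).
* `stub_caloricBootstrap`  (L+, HARDEST, lead) — "FreeKernelDecay → LocalSupBound" (`LocalSupBound` now
  carries the non-wrapping side condition `4ℓ < L`).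
* `stub_gaugeCovariance`   (S)  — "GaugeCovariance": colour-summed diagonal heat-kernel blocks and
  plaquette traces are gauge invariant (pure algebra over `wilsonDirac_gaugeTransform`).
* `stub_diagonalMonotone`  (S)  — "DiagonalMonotone": `t ↦ Re e^{-tAᴴA}(i,i)` is non-increasing.
* `stub_gaugeTransfer`     (M)  — "CombGauge → GaugeCovariance → DiagonalMonotone → LocalSupBound →
  DiagonalKernelBound": scale arithmetic only.
* `SmallFieldUltracontractivity_of` (kernel-checked, no `sorry` of its own): uses the seven stubs BY NAME and
  concludes the crux decl BY NAME (all colour–spin entries from the diagonal real parts by the landed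
  `norm_sq_exp_neg_smul_apply_le`, `exp_neg_smul_apply_self_eq_sum_norm_sq`).

## Disproof.lean honoured

`smallFieldUltracontractivity_false_without_t_le_rsq`: `t ≤ r²` is consumed in `stub_gaugeTransfer`
(comb cube of radius `2ℓ+1`, `ℓ ≍ √t/16`, inside the flat `r`-ball) and in LocalSupBound /
FreeKernelDecay through `s ≤ ℓ² < L²/16` (torus zero mode `L⁻⁴ ≲ (1+σ)⁻²`);
`…_false_without_r_le_L`: consumed by the non-wrapping conditions `4ℓ + 3 ≤ r ≤ L` / `4ℓ < L`;
`…_false_without_one_le_t`: cosmetic (small `t` trivial by `kernelEntry_le_one`);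
`body_holds_at_fixed_volume`: all constants are `L`-free; `not_smallFieldUltracontractivityExp`: every
stub outputs exactly `s⁻²`/`t⁻²`; near-miss `not_admissibleOnlyUltracontractivity` (§B): the coupling
`κ ≍ δℓ²` of the bootstrap diverges for a flat `ε` — scale covariance is used in `stub_gaugeTransfer`;
§C sup principle = LocalSupBound; §E: no targets filed.

## Where the seven stubs landed
(modules `…Theorems.HeatSlicedQuarksSmallFieldUltracontractivity<Suffix>`)

* `stub_combGauge` — StubCombGauge (p90661; aux StubCombGaugeAux p88740)
* `stub_freeKernelFourier` — StubFreeKernelFourier (p87364)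
* `stub_freeKernelDecay` — StubFreeKernelDecay (p92668; aux …Aux1 p87054, …Aux2 p87327, …Aux3 p91576)
* `stub_caloricBootstrap` — FixedPointE (p91843; main step FixedPointD3b p91317; parts D3a p89410,
  D2 p88729, D1 p88476, A p87574, B p87699, C p87830, BootHopping p86717, StubRowDuhamel p87900,
  StubHeatRowCalculus p88727, StubFreeRowBounds p87804, StubCommutatorBound p90730 + Aux p89065
  + Local p90001)
* `stub_gaugeCovariance` — StubGaugeCovariance (p86447)
* `stub_diagonalMonotone` — StubDiagonalMonotone (p85993)
* `stub_gaugeTransfer` — StubGaugeTransfer (p86334)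
-/

namespace Summit.QuantumFields.QCD.Cruxes.SmallFieldUltracontractivity.PointCentredAxialParabolic

open Literature.MathematicalPhysics.QuantumLattice Literature.MathematicalPhysics.QuantumFieldTheory
open Literature.Probability.LatticeModels (TorusSite torusChar)
open Summit.QuantumFields.QCD.Theorems.SmallFieldUltracontractivity.Negative
open scoped Matrix ComplexConjugate


/-! ### The seven stubs are LANDED theorems of this namespace (imported above); the composition follows. -/


/-! ### §2 Composition (no `sorry` below this line) -/

/-- **`SmallFieldUltracontractivity` from the seven stubs** (kernel-checked; uses the stubs BY NAME on its
first lines and nothing else; conclusion is the route decl BY NAME).  Comb gauge (S1), covariance (S4a),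
monotonicity (S4c) and the caloric bootstrap (S3, fed by the free decay S2) are turned into the diagonal
bound by the transfer (S4); the remaining colour–spin entries of the `(x,x)` block are dominated by the
diagonal real parts (`norm_sq_exp_neg_smul_apply_le`, with `0 ≤ Re e^{-tH}(i,i)` from
`exp_neg_smul_apply_self_eq_sum_norm_sq`, both LANDED in `Negative/Tightness.lean`), with the SAME
`ε, K, C`. -/
theorem SmallFieldUltracontractivity_of :
    Summit.QuantumFields.QCD.Theses.HeatSlicedQuarks.SmallFieldUltracontractivity := by
  have h₁ := stub_combGauge
  have h₂f := stub_freeKernelFourier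
  have h₂ := stub_freeKernelDecay h₂f
  have h₃ := stub_caloricBootstrap
  have h₄ := stub_gaugeCovariance
  have h₅ := stub_diagonalMonotone
  have h₆ := stub_gaugeTransfer
  obtain ⟨ε, hε, K, C, hC⟩ := h₆ h₁ h₄ h₅ (h₃ h₂)
  refine ⟨ε, hε, K, C, ?_⟩
  intro L _ U m hm x r hr hrL hflat t ht htr a b α β
  have hdiag := hC L U m hm x r hr hrL hflat t ht htr
  set D := wilsonDirac (fundamentalRep (Fin 3)) U m 1 with hD
  have hi : ((NormedSpace.exp (-(t : ℂ) • (Dᴴ * D))) (x, a, α) (x, a, α)).re ≤ C / t ^ 2 := hdiag a α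
  have hj : ((NormedSpace.exp (-(t : ℂ) • (Dᴴ * D))) (x, b, β) (x, b, β)).re ≤ C / t ^ 2 := hdiag b β
  have hre0 : ∀ i, 0 ≤ ((NormedSpace.exp (-(t : ℂ) • (Dᴴ * D))) i i).re := by
    intro i
    rw [exp_neg_smul_apply_self_eq_sum_norm_sq D t i, Complex.re_sum]
    exact Finset.sum_nonneg fun j _ => by rw [Complex.ofReal_re]; positivity
  have hCt : 0 ≤ C / t ^ 2 := (hre0 (x, a, α)).trans hi
  have hsq : ‖(NormedSpace.exp (-(t : ℂ) • (Dᴴ * D))) (x, a, α) (x, b, β)‖ ^ 2 ≤ (C / t ^ 2) ^ 2 :=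
    calc ‖(NormedSpace.exp (-(t : ℂ) • (Dᴴ * D))) (x, a, α) (x, b, β)‖ ^ 2
        ≤ ((NormedSpace.exp (-(t : ℂ) • (Dᴴ * D))) (x, a, α) (x, a, α)).re *
            ((NormedSpace.exp (-(t : ℂ) • (Dᴴ * D))) (x, b, β) (x, b, β)).re :=
          norm_sq_exp_neg_smul_apply_le D t (x, a, α) (x, b, β)
      _ ≤ (C / t ^ 2) * (C / t ^ 2) := mul_le_mul hi hj (hre0 (x, b, β)) hCt
      _ = (C / t ^ 2) ^ 2 := by ring
  exact (sq_le_sq₀ (norm_nonneg _) hCt).mp hsq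

end Summit.QuantumFields.QCD.Cruxes.SmallFieldUltracontractivity.PointCentredAxialParabolic
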